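import Summits.QuantumFields.YangMills.Theorems.FluctuationComparisonRegPrIntLOrganTangentFibreMeanTransport
import HarnessLib

/-!
# Crux `FluctuationComparisonRegPrIntL` (stmt-QuantumFields-20520, rung R3), PATH-B organ, v18 (H-currency) — (L21e) THE WINDOW UPGRADE JUNCTION:
# an a.e. bound under `descendTo_* dU_{Ts}` on an open sub-window becomes an EVERY-POINT bound (the knit's last step `∀ U V W Z`)

Cell `ym3-torus` (YM ladder rung R3 = continuum `SU(2)` Yang–Mills on the three-torus — a RUNG: NOT d = 4, NOT infinite volume, NOT a mass gap, NOT Clay).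
Width seat `ym-ust-20520-w5` (gen 23), `--supports stmt-QuantumFields-20520 --as helper`, count-neutral, no registry ∕ binder ∕ `Lines/` edit, DEFINITION-FREE,
default heartbeats.  Over (L21b) ✓p809169 (`abs_le_on_of_ae_fieldMeasure`, `isOpen_fourCornerWindow`) and ✓KNIT `OrganTangentFibreMeanVersionKnit.ae_on_of_ae_map_of_ac_of_map_eq`.

WHAT THIS IS.  The LIN knit (LEAD w3 g25 №23∕№25) produces its four-channel bound at `(descendTo_* dU_{Ts})`-a.e. reference corner (✓L21c∕✓L21d), for each FIXED
move pair `(b, v, b′, v′)`; LINᵘ-H′ concludes at EVERY window corner.  ★★`abs_le_on_of_ae_map_descendTo` is the two-step junction, by name: (1) move the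
`(descendTo_* dU_{Ts})`-a.e. statement to «`dU_j`-a.e. on the window `{PlaqSmall θ}`» through ANY `mY ≪ dU_{Ts}` with `mY.map (descendTo j Ts) = rj·dU_j`, `rj > 0` on the
window (the cut run tower's top law, as in ✓(L17)∕(L20)∕(L21b)); (2) `dU_j` charges open sets and the sub-window `O ⊆ {PlaqSmall θ}` is open, so an `O`-continuous `f`
with `|f| ≤ K` a.e. on `O` has `|f| ≤ K` ON `O` (✓`abs_le_on_of_ae_fieldMeasure`).  ★`abs_le_fourCorner_of_ae_map_descendTo` is the instance `O :=` the four-corner window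
of two continuous moves `g₁ g₂` inside `{PlaqSmall θ}` (✓`isOpen_fourCornerWindow`), i.e. exactly the set over which LINᵘ-H′'s `∀ U V W Z` ranges for fixed `(b, v, b′, v′)`.

HONEST FRAMING: null-set bookkeeping; nothing of Bałaban's analysis is asserted or proved; LINᵘ-H′ ∕ O1ᵘ-H v2.1 ∕ FibreLawH ∕ S1aᴴ ∕ 26243 ∕ S2α′ ∕ S2β OPEN; crux 20520
`FluctuationComparisonRegPrIntL` ∕ `YM3TorusSU2` NOT proved; no summit ∕ sub-problem statement is proved; registry untouched; rung R3 = SU(2) YM₃ on T³ at fixed lattice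
data — NOT d = 4, NOT infinite volume, NOT a mass gap, NOT Clay; the Yang–Mills mass gap is NOT proved.  [folklore].
-/

set_option autoImplicit false

noncomputable section

namespace Summit.QuantumFields.YangMills.Theorems.OrganTangentWindowUpgrade

open MeasureTheory Filter Topology Set
open scoped ENNReal
open Literature.MathematicalPhysics.QuantumFieldTheory.Balaban1983to89
open T3ContinuumYM3Torus T3NestedUnitLaws T3UnitLawDensityEML T3UnitScaleTilt T3TiltDescent
open Literature.MathematicalPhysics.QuantumFieldTheory.Balaban1983to89.T3OrbitAverage
open Summit.QuantumFields.YangMills.Theorems.OrganTangentFibreMeanTransport (abs_le_on_of_ae_fieldMeasure isOpen_fourCornerWindow)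

/-- ★★ **a.e. UNDER `descendTo_* dU_{Ts}` ⟹ EVERYWHERE ON AN OPEN SUB-WINDOW** (see the module docstring).
[cite: Balaban1985Averaging, (10)-(13) p.19; Balaban1987RG1, p.259] (bookkeeping locators; [folklore]) -/
theorem abs_le_on_of_ae_map_descendTo (F : T3Family) (j Ts : ℕ) (hjTs : j + 1 ≤ Ts) (θ K : ℝ)
    (mY : Measure (GaugeField (F.P Ts) 0 ↥(Matrix.specialUnitaryGroup (Fin 2) ℂ)))
    (hmY : mY ≪ fieldMeasure (F.P Ts) 0 ↥(Matrix.specialUnitaryGroup (Fin 2) ℂ))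
    (rj : GaugeField (F.P j) 0 ↥(Matrix.specialUnitaryGroup (Fin 2) ℂ) → ℝ) (hrj : Measurable rj) (hrjpos : ∀ V, PlaqSmall θ V → 0 < rj V)
    (hcons : mY.map (descendTo F ℰp j Ts (Nat.le_of_succ_le hjTs)) =
      (fieldMeasure (F.P j) 0 ↥(Matrix.specialUnitaryGroup (Fin 2) ℂ)).withDensity (fun V => ENNReal.ofReal (rj V)))
    {O : Set (GaugeField (F.P j) 0 ↥(Matrix.specialUnitaryGroup (Fin 2) ℂ))} (hO : IsOpen O) (hOW : O ⊆ {V | PlaqSmall θ V})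
    {f : GaugeField (F.P j) 0 ↥(Matrix.specialUnitaryGroup (Fin 2) ℂ) → ℝ} (hf : ContinuousOn f O)
    (h : ∀ᵐ W ∂(Measure.map (descendTo F ℰp j Ts (Nat.le_of_succ_le hjTs)) (fieldMeasure (F.P Ts) 0 ↥(Matrix.specialUnitaryGroup (Fin 2) ℂ))),
      W ∈ O → |f W| ≤ K) :
    ∀ W ∈ O, |f W| ≤ K := by
  have hd : Measurable (descendTo F ℰp j Ts (Nat.le_of_succ_le hjTs) :
      GaugeField (F.P Ts) 0 ↥(Matrix.specialUnitaryGroup (Fin 2) ℂ) → GaugeField (F.P j) 0 ↥(Matrix.specialUnitaryGroup (Fin 2) ℂ)) :=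
    measurable_descendTo F ℰp measurableE_ℰp _
  have hρX : AEMeasurable (fun V => ENNReal.ofReal (rj V)) (fieldMeasure (F.P j) 0 ↥(Matrix.specialUnitaryGroup (Fin 2) ℂ)) :=
    hrj.ennreal_ofReal.aemeasurable
  have hWne : ∀ V ∈ {V : GaugeField (F.P j) 0 ↥(Matrix.specialUnitaryGroup (Fin 2) ℂ) | PlaqSmall θ V}, ENNReal.ofReal (rj V) ≠ 0 :=
    fun V hV => (ENNReal.ofReal_pos.mpr (hrjpos V hV)).ne'
  have h1 := OrganTangentFibreMeanVersionKnit.ae_on_of_ae_map_of_ac_of_map_eq _ hd _ mY hmY hρX hcons hWne h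
  have h2 : ∀ᵐ W ∂(fieldMeasure (F.P j) 0 ↥(Matrix.specialUnitaryGroup (Fin 2) ℂ)), W ∈ O → |f W| ≤ K := by
    filter_upwards [h1] with W hW hWO
    exact hW (hOW hWO) hWO
  exact abs_le_on_of_ae_fieldMeasure (F.P j) 0 hO K hf h2

/-- ★ **THE FOUR-CORNER INSTANCE**: `O :=` the four-corner window `{U | U, g₁U, g₂U, g₂(g₁U) ∈ {PlaqSmall θ}}` of two continuous coarse moves (the range of
LINᵘ-H′'s `∀ U V W Z` for a fixed move pair). [cite: Balaban1987RG1, p.259] (bookkeeping; [folklore]) -/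
theorem abs_le_fourCorner_of_ae_map_descendTo (F : T3Family) (j Ts : ℕ) (hjTs : j + 1 ≤ Ts) (θ K : ℝ)
    (mY : Measure (GaugeField (F.P Ts) 0 ↥(Matrix.specialUnitaryGroup (Fin 2) ℂ)))
    (hmY : mY ≪ fieldMeasure (F.P Ts) 0 ↥(Matrix.specialUnitaryGroup (Fin 2) ℂ))
    (rj : GaugeField (F.P j) 0 ↥(Matrix.specialUnitaryGroup (Fin 2) ℂ) → ℝ) (hrj : Measurable rj) (hrjpos : ∀ V, PlaqSmall θ V → 0 < rj V)
    (hcons : mY.map (descendTo F ℰp j Ts (Nat.le_of_succ_le hjTs)) =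
      (fieldMeasure (F.P j) 0 ↥(Matrix.specialUnitaryGroup (Fin 2) ℂ)).withDensity (fun V => ENNReal.ofReal (rj V)))
    {g₁ g₂ : GaugeField (F.P j) 0 ↥(Matrix.specialUnitaryGroup (Fin 2) ℂ) → GaugeField (F.P j) 0 ↥(Matrix.specialUnitaryGroup (Fin 2) ℂ)}
    (hg₁ : Continuous g₁) (hg₂ : Continuous g₂)
    {f : GaugeField (F.P j) 0 ↥(Matrix.specialUnitaryGroup (Fin 2) ℂ) → ℝ}
    (hf : ContinuousOn f {U | PlaqSmall θ U ∧ PlaqSmall θ (g₁ U) ∧ PlaqSmall θ (g₂ U) ∧ PlaqSmall θ (g₂ (g₁ U))})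
    (h : ∀ᵐ W ∂(Measure.map (descendTo F ℰp j Ts (Nat.le_of_succ_le hjTs)) (fieldMeasure (F.P Ts) 0 ↥(Matrix.specialUnitaryGroup (Fin 2) ℂ))),
      (PlaqSmall θ W ∧ PlaqSmall θ (g₁ W) ∧ PlaqSmall θ (g₂ W) ∧ PlaqSmall θ (g₂ (g₁ W))) → |f W| ≤ K) :
    ∀ W : GaugeField (F.P j) 0 ↥(Matrix.specialUnitaryGroup (Fin 2) ℂ),
      PlaqSmall θ W → PlaqSmall θ (g₁ W) → PlaqSmall θ (g₂ W) → PlaqSmall θ (g₂ (g₁ W)) → |f W| ≤ K := by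
  have hO := isOpen_fourCornerWindow (F.P j) 0 θ hg₁ hg₂
  have hOW : {U : GaugeField (F.P j) 0 ↥(Matrix.specialUnitaryGroup (Fin 2) ℂ) |
      PlaqSmall θ U ∧ PlaqSmall θ (g₁ U) ∧ PlaqSmall θ (g₂ U) ∧ PlaqSmall θ (g₂ (g₁ U))} ⊆ {V | PlaqSmall θ V} :=
    fun U hU => hU.1
  have key := abs_le_on_of_ae_map_descendTo F j Ts hjTs θ K mY hmY rj hrj hrjpos hcons hO hOW hf h
  intro W h0 h1 h2 h3
  exact key W ⟨h0, h1, h2, h3⟩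

end Summit.QuantumFields.YangMills.Theorems.OrganTangentWindowUpgrade

end
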